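import Mathlib.Geometry.Manifold.IntegralCurve.ExistUnique
import Summits.FinalStateConjecture.FinalStateConjecture.Theorems.ZeroEnergyKerrOrBombHawkingExtensionIsKerrRestrictTransport
import Summits.FinalStateConjecture.FinalStateConjecture.Theorems.ZeroEnergyKerrOrBombHawkingExtensionIsKerrNHOneSidedTaylor
import Summits.FinalStateConjecture.FinalStateConjecture.Theorems.ZeroEnergyKerrOrBombHawkingExtensionIsKerrNHSecondDerivative
import Summits.FinalStateConjecture.FinalStateConjecture.Theorems.ZeroEnergyKerrOrBombHawkingExtensionIsKerrNHSecondFF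
import Summits.FinalStateConjecture.FinalStateConjecture.Theorems.ZeroEnergyKerrOrBombHawkingExtensionIsKerrNHCurvatureAlgebra
import Summits.FinalStateConjecture.FinalStateConjecture.Theorems.ZeroEnergyKerrOrBombHawkingExtensionIsKerrNHNullFrame
import Literature.Geometry.Lorentzian.HorizonSphericalSection
import Literature.Geometry.Lorentzian.IPlusRegular
import Literature.Geometry.Lorentzian.IsometryProofs
import Literature.Geometry.Riemannian.GaussBonnet
import Literature.Topology.Euclidean.PoincareHopfLevelSurface
import HarnessLib

/-!
# Crux `HawkingExtensionIsKerr` (stmt-FinalStateConjecture-17840), line `SketchIdeator2` —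
# programme NH: the assembly — a degenerate vacuum Killing horizon admits no Killing-causal collar

Helper file of the line lead (c5), registered sub-goal `stub_nh_assembly`.  THE THEOREM
(`noCollar_of_bricks`): the statement of the Literature fact `DegenerateVacuumHorizonNoCollar`
GIVEN the smooth local defining functions of the horizon (programme HR of c4), derived from the NH
bricks, taken as hypotheses in their registered forms (all LANDED: `…NHOneSidedTaylor` p155467,
`…NHSecondDerivative` p155709, `…NHCurvatureAlgebra` p155941, `…NHSecondFF` p155792,
`…NHNullFrame` p155977; the null Gauss equation `stub_nh_gaussNull` is the lead's remaining stub) and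
the named fact `chruscielCosta2008_horizonSphericalSection` (Chruściel–Costa 2008 Thm 4.11 /
Prop 4.3 / Cor 2.5, ACCEPTED p155351).

PROOF (invariant near-horizon sign analysis; no Gaussian null coordinates).  Suppose `K` is causal
on `V ∩ ⟨⟨M_ext⟩⟩` for an open `V ⊇ 𝓔⁺`.  Work on the open sub-carrier `W = U ∩ V`, where `K` is a
global Killing field of the restricted (vacuum) metric (`…RestrictTransport`).  Let `ι : T → 𝓔⁺`
be the smooth spherical section, lifted to `W`, with induced Riemannian metric `γ`.  At `p = ι t`:
the defining function `F` makes `K ⊥ dι(T T)` near `t` and, by NH4, `g(∇_{dι v} K, dι w) = 0`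
(`B = 0`); the null frame (NH-F) gives an orthonormal pair `dι e₁, dι e₂` and a null `N ⊥ dι(T_t T)`
with `g(K, N) ≠ 0`; along an integral curve `γc` of an extension `Y` of `N` the function
`φ = g(K,K) ∘ γc` has `φ(0) = φ'(0) = 0` (degenerate) and `φ ≤ 0` where `F ∘ γc < 0` (the collar),
while `(F ∘ γc)'(0) = c g(K, N) ≠ 0`, so NH1 + NH2 give
`Q(N) = g(R(N,K)N, K) + g(∇_N K, ∇_N K) ≤ 0`; NH3 (vacuum) turns `g(R(N,K)N,K)` into
`g(K,N)² · g(R(dι e₂, dι e₁) dι e₁, dι e₂)`, and `∇_N K ⊥ K, N` is spacelike (NH-F), so the ambient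
sectional curvature of `dι(T_t T)` is `≤ 0`; by the null Gauss equation (NH-G) and `S = 2K` (NH6)
the scalar curvature of `γ` is `≤ 0` at every `t`.  But `∫_T S_γ dA = 4π χ(T) = 8π`
(`Literature.Geometry.Riemannian.gaussBonnet`, `finRelHomology_sphere_two`,
`relEuler_eq_of_homeomorph`) — contradiction.
-/

noncomputable section

set_option linter.dupNamespace false

namespace Summit.FinalStateConjecture.FinalStateConjecture.Theorems.HawkingExtensionIsKerr.SketchIdeator2

open Set Filter Bundle Function TopologicalSpace MeasureTheory Literature.Geometry.Lorentzian
open Literature.Geometry.Manifold.OpenSubmanifold Literature.AlgebraicTopology.SingularHomology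
open scoped Manifold ContDiff Topology

/-! ### The assembly -/

section Assembly

set_option maxHeartbeats 3200000 in
/-- **NH assembly: a degenerate vacuum Killing horizon with spherical smooth sections admits no
Killing-causal collar** — the statement of `DegenerateVacuumHorizonNoCollar` given the smooth local
defining functions of the horizon, from the NH bricks (one-sided Taylor, second derivative along an
integral curve, null-frame curvature algebra and `S = 2K`, `B = 0`, the null Gauss equation, the
null frame) and the spherical-section fact.  See the module docstring for the proof. -/
theorem noCollar_of_bricks
    (hT : ∀ (φ φ' ψ : ℝ → ℝ) (a : ℝ), (∀ᶠ t in 𝓝 (0 : ℝ), HasDerivAt φ (φ' t) t) → HasDerivAt φ' a 0 → DifferentiableAt ℝ ψ 0 → (∀ᶠ t in 𝓝 (0 : ℝ), ψ t < 0 → φ t ≤ 0) → ψ 0 = 0 → φ 0 = 0 → deriv ψ 0 ≠ 0 → φ' 0 = 0 → a ≤ 0)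
    (hD : ∀ (M : Type) [TopologicalSpace M] [ChartedSpace E4 M] [IsManifold (𝓡 4) ∞ M] (g : PseudoRiemannianMetric (𝓡 4) ∞ E4 (TangentSpace (𝓡 4) : M → Type _)) [g.HasLeviCivita] (K Y : Π x : M, TangentSpace (𝓡 4) x) (γ : ℝ → M) (p : M), g.IsKillingField K → (∀ᶠ x in 𝓝 p, ContMDiffAt (𝓡 4) ((𝓡 4).prod 𝓘(ℝ, E4)) ∞ (fun y ↦ (Bundle.TotalSpace.mk' E4 y (Y y) : TangentBundle (𝓡 4) M)) x) → γ 0 = p → (∀ᶠ t in 𝓝 (0 : ℝ), HasMFDerivAt 𝓘(ℝ, ℝ) (𝓡 4) γ t ((1 : ℝ →L[ℝ] ℝ).smulRight (Y (γ t)))) → g.leviCivita K p (K p) = 0 → mvfderiv (𝓡 4) (fun y ↦ g.val y (K y) (K y)) p (Y p) = 0 ∧ (∀ᶠ t in 𝓝 (0 : ℝ), HasDerivAt (fun t ↦ g.val (γ t) (K (γ t)) (K (γ t))) (mvfderiv (𝓡 4) (fun y ↦ g.val y (K y) (K y)) (γ t) (Y (γ t))) t) ∧ HasDerivAt (fun t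 ↦ mvfderiv (𝓡 4) (fun y ↦ g.val y (K y) (K y)) (γ t) (Y (γ t))) (2 * (g.val p (g.riemann p (Y p) (K p) (Y p)) (K p) + g.val p (g.leviCivita K p (Y p)) (g.leviCivita K p (Y p)))) 0)
    (hC : (∀ (M : Type) [TopologicalSpace M] [ChartedSpace E4 M] [IsManifold (𝓡 4) ∞ M] (g : PseudoRiemannianMetric (𝓡 4) ∞ E4 (TangentSpace (𝓡 4) : M → Type _)) [g.HasLeviCivita] (p : M) (K N e₁ e₂ : TangentSpace (𝓡 4) p), g.ricci p = 0 → g.val p K K = 0 → g.val p N N = 0 → g.val p K N ≠ 0 → g.val p e₁ e₁ = 1 → g.val p e₂ e₂ = 1 → g.val p e₁ e₂ = 0 → g.val p K e₁ = 0 → g.val p K e₂ = 0 → g.val p N e₁ = 0 → g.val p N e₂ = 0 → g.val p (g.riemann p N K N) K = (g.val p K N) ^ 2 * g.val p (g.riemann p e₂ e₁ e₁) e₂) ∧ (∀ (S : Type) [TopologicalSpace S] [ChartedSpace (EuclideanSpace ℝ (Fin 2)) S] [IsManifold (𝓡 2) ∞ S] (γ : PseudoRiemannianMetric (𝓡 2)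 ∞ (EuclideanSpace ℝ (Fin 2)) (TangentSpace (𝓡 2) : S → Type _)) [γ.HasLeviCivita] (s : S) (e₁ e₂ : TangentSpace (𝓡 2) s), γ.val s e₁ e₁ = 1 → γ.val s e₂ e₂ = 1 → γ.val s e₁ e₂ = 0 → γ.scalarCurvature s = 2 * γ.val s (γ.riemann s e₂ e₁ e₁) e₂))
    (hB : ∀ (M : Type) [TopologicalSpace M] [ChartedSpace E4 M] [IsManifold (𝓡 4) ∞ M] (g : PseudoRiemannianMetric (𝓡 4) ∞ E4 (TangentSpace (𝓡 4) : M → Type _)) [g.HasLeviCivita] (K : Π x : M, TangentSpace (𝓡 4) x) (F : M → ℝ) (p : M) (c : ℝ), g.IsKillingField K → (∀ᶠ x in 𝓝 p, ContMDiffAt (𝓡 4) 𝓘(ℝ, ℝ) ∞ F x) → F p = 0 → K p ≠ 0 → c ≠ 0 → (∀ w : TangentSpace (𝓡 4) p, mvfderiv (𝓡 4) F p w = c * g.val p (K p) w) → (∀ᶠ x in 𝓝 p, F x = 0 → ∃ c' : ℝ, c' ≠ 0 ∧ ∀ w : TangentSpace (𝓡 4) x, mvfderiv (𝓡 4) F x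 w = c' * g.val x (K x) w) → ∀ X Z : TangentSpace (𝓡 4) p, mvfderiv (𝓡 4) F p X = 0 → mvfderiv (𝓡 4) F p Z = 0 → g.val p (g.leviCivita K p X) Z = 0)
    (hG : ∀ (M : Type) [TopologicalSpace M] [ChartedSpace E4 M] [IsManifold (𝓡 4) ∞ M] (g : PseudoRiemannianMetric (𝓡 4) ∞ E4 (TangentSpace (𝓡 4) : M → Type _)) [g.HasLeviCivita] (S : Type) [TopologicalSpace S] [ChartedSpace (EuclideanSpace ℝ (Fin 2)) S] [IsManifold (𝓡 2) ∞ S] (ι : S → M) (hι : g.IsSpacelikeImmersion (𝓡 2) ι) (K : Π x : M, TangentSpace (𝓡 4) x) (U : Set M) (s : S) (N : TangentSpace (𝓡 4) (ι s)), IsOpen U → ι s ∈ U → ContMDiffOn (𝓡 4) ((𝓡 4).prod 𝓘(ℝ, E4)) ∞ (fun x ↦ (Bundle.TotalSpace.mk' E4 x (K x) : TangentBundle (𝓡 4) M)) U → (∀ᶠ y in 𝓝 s, ∀ w : TangentSpace (𝓡 2) y, g.val (ι y) (K (ι y)) (mfderiv (𝓡 2) (𝓡 4) ι y w) = 0) →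 g.val (ι s) (K (ι s)) (K (ι s)) = 0 → g.val (ι s) N N = 0 → g.val (ι s) (K (ι s)) N ≠ 0 → (∀ w : TangentSpace (𝓡 2) s, g.val (ι s) N (mfderiv (𝓡 2) (𝓡 4) ι s w) = 0) → (∀ v w : TangentSpace (𝓡 2) s, g.val (ι s) (g.leviCivita K (ι s) (mfderiv (𝓡 2) (𝓡 4) ι s v)) (mfderiv (𝓡 2) (𝓡 4) ι s w) = 0) → ∀ [(g.inducedMetric ι PseudoRiemannianMetric.contMDiff_pullbackBilin_holds hι).HasLeviCivita], ∀ v w : TangentSpace (𝓡 2) s, (g.inducedMetric ι PseudoRiemannianMetric.contMDiff_pullbackBilin_holds hι).val s ((g.inducedMetric ι PseudoRiemannianMetric.contMDiff_pullbackBilin_holds hι).riemann s v w w) v = g.val (ι s) (g.riemann (ι s) (mfderiv (𝓡 2) (𝓡 4) ι s v) (mfderiv (𝓡 2) (𝓡 4) ι s w) (mfderiv (𝓡 2) (𝓡 4) ι s w)) (mfderiv (𝓡 2) (𝓡 4) ι s v))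
    (hF : ∀ (M : Type) [TopologicalSpace M] [ChartedSpace E4 M] [IsManifold (𝓡 4) ∞ M] (g : PseudoRiemannianMetric (𝓡 4) ∞ E4 (TangentSpace (𝓡 4) : M → Type _)) (p : M) (A : EuclideanSpace ℝ (Fin 2) →L[ℝ] TangentSpace (𝓡 4) p) (K : TangentSpace (𝓡 4) p), (∀ w, w ≠ 0 → 0 < g.val p (A w) (A w)) → K ≠ 0 → g.val p K K = 0 → (∀ w, g.val p K (A w) = 0) → ∃ (e₁ e₂ : EuclideanSpace ℝ (Fin 2)) (N : TangentSpace (𝓡 4) p), g.val p (A e₁) (A e₁) = 1 ∧ g.val p (A e₂) (A e₂) = 1 ∧ g.val p (A e₁) (A e₂) = 0 ∧ g.val p N N = 0 ∧ g.val p K N ≠ 0 ∧ (∀ w, g.val p N (A w) = 0) ∧ ∀ X : TangentSpace (𝓡 4) p, g.val p X K = 0 → g.val p X N = 0 → g.val p X X = g.val p X (A e₁) ^ 2 + g.val p X (A e₂) ^ 2)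
    (hS : chruscielCosta2008_horizonSphericalSection) :
    ∀ (𝓑 : StationaryAFBlackHole.{0}) [𝓑.metric.HasLeviCivita], 𝓑.metric.toPseudoRiemannianMetric.IsRicciFlat → 𝓑.IsIPlusRegular → IsConnected 𝓑.horizon → SimplyConnectedSpace 𝓑.doc → ∀ (U : Set 𝓑.carrier) (K : Π x : 𝓑.carrier, TangentSpace (𝓡 4) x), IsOpen U → 𝓑.horizon ⊆ U → 𝓑.metric.toPseudoRiemannianMetric.IsKillingFieldOn K U → (∀ x ∈ U, VectorField.mlieBracket (𝓡 4) 𝓑.killing K x = 0) → (∀ p ∈ 𝓑.horizon, K p ≠ 0) → (∀ p ∈ 𝓑.horizon, 𝓑.metric.val p (K p) (K p) = 0) → (∀ p ∈ 𝓑.horizon, ∃ ε > (0 : ℝ), ∃ γ : ℝ → 𝓑.carrier, γ 0 = p ∧ IsMIntegralCurveOn γ K (Set.Ioo (-ε) ε) ∧ ∀ t ∈ Set.Ioo (-ε) ε, γ t ∈ 𝓑.horizon) → (∀ p ∈ 𝓑.horizon, 𝓑.metric.leviCivita K p (K p) = 0) → (∀ p ∈ 𝓑.horizon, ∃ W : Set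 𝓑.carrier, IsOpen W ∧ p ∈ W ∧ W ⊆ U ∧ ∃ F : 𝓑.carrier → ℝ, ContMDiffOn (𝓡 4) 𝓘(ℝ, ℝ) ((⊤ : ℕ∞) : WithTop ℕ∞) F W ∧ (∀ x ∈ W, x ∈ 𝓑.horizon ↔ F x = 0) ∧ (∀ x ∈ W, x ∈ 𝓑.doc ↔ F x < 0) ∧ ∀ x ∈ W ∩ 𝓑.horizon, ∃ c : ℝ, c ≠ 0 ∧ ∀ w : TangentSpace (𝓡 4) x, mfderiv (𝓡 4) 𝓘(ℝ, ℝ) F x w = c * 𝓑.metric.val x (K x) w) → ∀ V : Set 𝓑.carrier, IsOpen V → 𝓑.horizon ⊆ V → ∃ x ∈ V ∩ 𝓑.doc, 0 < 𝓑.metric.val x (K x) (K x) := by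
  intro 𝓑 _ hvac hreg hconn hsc U K hU hHU hKon _hKc hKne hnull _htan hdeg hdef V hV hHV
  by_contra hno
  push Not at hno
  -- ## the smooth spherical section
  obtain ⟨T, _, _, _, eT, ι, hιsp, _hιinj, hιH, -⟩ := hS 𝓑 hvac hreg hconn hsc
  haveI : CompactSpace T := eT.symm.compactSpace
  haveI : T2Space T := eT.symm.t2Space
  -- ## the open sub-carrier `W = U ∩ V`
  set W : Set 𝓑.carrier := U ∩ V with hWdef
  have hWopen : IsOpen W := hU.inter hV
  have hHW : 𝓑.horizon ⊆ W := fun q hq ↦ ⟨hHU hq, hHV hq⟩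
  have hWU : W ⊆ U := inter_subset_left
  set W' : Opens 𝓑.carrier := ⟨W, hWopen⟩ with hW'def
  set gW := (𝓑.metric.restrict PseudoRiemannianMetric.contMDiff_restrict_holds W').toPseudoRiemannianMetric
    with hgWdef
  haveI hgWLC : gW.HasLeviCivita := gW.hasLeviCivita
  set KW : Π y : W', TangentSpace (𝓡 4) y := fun y ↦ (K y.1 : TangentSpace (𝓡 4) y) with hKWdef
  have hKW : gW.IsKillingField KW := isKillingField_restrict_of_isKillingFieldOn 𝓑 W' hU hWU hKon
  have hvacW : gW.IsRicciFlat := isRicciFlat_restrict_of_isRicciFlat 𝓑 W' hvac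
  have hvalW : ∀ (y : W') (v w : TangentSpace (𝓡 4) y), gW.val y v w = 𝓑.metric.val y.1 v w :=
    fun _ _ _ ↦ rfl
  have hLCW : ∀ (y : W') (v : TangentSpace (𝓡 4) y),
      gW.leviCivita KW y v = 𝓑.metric.leviCivita K y.1 v := fun y v ↦
    leviCivita_restrict_apply_of_mdifferentiableAt 𝓑 W' y (hKon.mdifferentiableAt hU (hWU y.2)) v
  -- ## the section lifted to `W'`
  set ιW : T → W' := fun t ↦ ⟨ι t, hHW (hιH ⟨t, rfl⟩)⟩ with hιWdef
  have hιsmooth : ContMDiff (𝓡 2) (𝓡 4) ∞ ι := hιsp.contMDiff_self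
  have hιWsmooth : ContMDiff (𝓡 2) (𝓡 4) ∞ ιW :=
    (ContMDiff.subtypeVal_comp_iff W' ιW).1 hιsmooth
  have hdιW : ∀ (t : T) (v : TangentSpace (𝓡 2) t),
      mfderiv (𝓡 2) (𝓡 4) ιW t v = mfderiv (𝓡 2) (𝓡 4) ι t v := by
    intro t v
    have h1 : HasMFDerivAt (𝓡 2) (𝓡 4) ιW t (mfderiv (𝓡 2) (𝓡 4) ιW t) :=
      (hιWsmooth.mdifferentiableAt (by simp)).hasMFDerivAt
    have h2 := (hasMFDerivAt_subtype_val (I := 𝓡 4) (ιW t)).comp t h1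
    have h3 : mfderiv (𝓡 2) (𝓡 4) (Subtype.val ∘ ιW) t =
        (ContinuousLinearMap.id ℝ E4).comp (mfderiv (𝓡 2) (𝓡 4) ιW t) := h2.mfderiv
    have h4 : (Subtype.val ∘ ιW) = ι := rfl
    rw [h4] at h3
    rw [h3]
    rfl
  have hιWsp : gW.IsSpacelikeImmersion (𝓡 2) ιW := by
    refine ⟨hιWsmooth, fun t v hv ↦ ?_⟩
    have h := hιsp.2 t v hv
    simp only [PseudoRiemannianMetric.inducedBilin_apply] at h ⊢
    rw [hvalW, hdιW]
    exact h
  set γT := gW.inducedMetric ιW PseudoRiemannianMetric.contMDiff_pullbackBilin_holds hιWsp with hγTdef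
  haveI hγLC : γT.HasLeviCivita := γT.hasLeviCivita
  have hγR : γT.IsRiemannian :=
    PseudoRiemannianMetric.isRiemannian_inducedMetric gW ιW _ hιWsp
  have hγval : ∀ (t : T) (v w : TangentSpace (𝓡 2) t),
      γT.val t v w = gW.val (ιW t) (mfderiv (𝓡 2) (𝓡 4) ιW t v) (mfderiv (𝓡 2) (𝓡 4) ιW t w) :=
    fun _ _ _ ↦ rfl
  -- ## the scalar curvature of `γ` is non-positive at every point
  have hSle : ∀ t : T, γT.scalarCurvature t ≤ 0 := by
    intro t
    -- ### the point and the horizon data there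
    set pW : W' := ιW t with hpWdef
    have hpι : pW.1 = ι t := rfl
    have hpH : pW.1 ∈ 𝓑.horizon := hιH ⟨t, rfl⟩
    have hKp0 : KW pW ≠ 0 := hKne _ hpH
    have hKnull : gW.val pW (KW pW) (KW pW) = 0 := hnull _ hpH
    have hdegW : gW.leviCivita KW pW (KW pW) = 0 := by rw [hLCW]; exact hdeg _ hpH
    -- ### the defining function at `p`
    obtain ⟨Wd, hWd, hpWd, -, F, hFs, hFH, hFdoc, hFc⟩ := hdef pW.1 hpH
    obtain ⟨c, hc, hdF⟩ := hFc pW.1 ⟨hpWd, hpH⟩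
    set FW : W' → ℝ := fun y ↦ F y.1 with hFWdef
    have hFWp : FW pW = 0 := (hFH _ hpWd).1 hpH
    -- `F` is smooth at the points of `Wd`
    have hFat : ∀ x ∈ Wd, ContMDiffAt (𝓡 4) 𝓘(ℝ, ℝ) ∞ F x := fun x hx ↦
      (hFs x hx).contMDiffAt (hWd.mem_nhds hx)
    have hFWat : ∀ y : W', y.1 ∈ Wd → ContMDiffAt (𝓡 4) 𝓘(ℝ, ℝ) ∞ FW y := fun y hy ↦
      (hFat y.1 hy).comp y (contMDiff_subtype_val y)
    -- points of `W'` near `pW` project into `Wd`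
    have hnear : ∀ᶠ y in 𝓝 pW, y.1 ∈ Wd :=
      continuous_subtype_val.continuousAt.preimage_mem_nhds (hWd.mem_nhds hpWd)
    have hFWsmooth : ∀ᶠ y in 𝓝 pW, ContMDiffAt (𝓡 4) 𝓘(ℝ, ℝ) ∞ FW y :=
      hnear.mono fun y hy ↦ hFWat y hy
    -- `dFW_y = dF_{↑y}` on `Wd`
    have hdFW : ∀ y : W', y.1 ∈ Wd → ∀ w : TangentSpace (𝓡 4) y,
        mvfderiv (𝓡 4) FW y w = mfderiv (𝓡 4) 𝓘(ℝ, ℝ) F y.1 w := by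
      intro y hy w
      have hFd : MDifferentiableAt (𝓡 4) 𝓘(ℝ, ℝ) F y.1 :=
        (hFat y.1 hy).mdifferentiableAt (by simp)
      have h := (hFd.hasMFDerivAt).comp y (hasMFDerivAt_subtype_val (I := 𝓡 4) y)
      have h' : mfderiv (𝓡 4) 𝓘(ℝ, ℝ) (F ∘ Subtype.val) y =
          (mfderiv (𝓡 4) 𝓘(ℝ, ℝ) F y.1).comp (ContinuousLinearMap.id ℝ E4) := h.mfderiv
      change mfderiv (𝓡 4) 𝓘(ℝ, ℝ) (F ∘ Subtype.val) y w = _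
      rw [h']
      rfl
    have hdFWp : ∀ w : TangentSpace (𝓡 4) pW, mvfderiv (𝓡 4) FW pW w = c * gW.val pW (KW pW) w := by
      intro w
      rw [hdFW pW hpWd w, hdF w]
      rfl
    have hdFWnear : ∀ᶠ y in 𝓝 pW, FW y = 0 → ∃ c' : ℝ, c' ≠ 0 ∧
        ∀ w : TangentSpace (𝓡 4) y, mvfderiv (𝓡 4) FW y w = c' * gW.val y (KW y) w := by
      filter_upwards [hnear] with y hy hFy
      have hyH : y.1 ∈ 𝓑.horizon := (hFH _ hy).2 hFy
      obtain ⟨c', hc', hdF'⟩ := hFc y.1 ⟨hy, hyH⟩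
      exact ⟨c', hc', fun w ↦ by rw [hdFW y hy w, hdF' w]; rfl⟩
    -- ### NH4: `B = 0` on `ker dF_p`
    have hBW : ∀ X Z : TangentSpace (𝓡 4) pW, mvfderiv (𝓡 4) FW pW X = 0 →
        mvfderiv (𝓡 4) FW pW Z = 0 → gW.val pW (gW.leviCivita KW pW X) Z = 0 :=
      hB W' gW KW FW pW c hKW hFWsmooth hFWp hKp0 hc hdFWp hdFWnear
    -- ### the plane `A(T_t T)` and `K ⊥ A(T T)` near `t`
    set A : EuclideanSpace ℝ (Fin 2) →L[ℝ] TangentSpace (𝓡 4) pW := mfderiv (𝓡 2) (𝓡 4) ιW t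
      with hAdef
    have hApos : ∀ w : EuclideanSpace ℝ (Fin 2), w ≠ 0 → 0 < gW.val pW (A w) (A w) := fun w hw ↦
      hιWsp.2 t w hw
    have hιcont : Continuous ι := hιsmooth.continuous
    have htnear : ∀ᶠ y in 𝓝 t, ι y ∈ Wd := hιcont.continuousAt.preimage_mem_nhds (hWd.mem_nhds hpWd)
    have hzero : ∀ᶠ y in 𝓝 t, (FW ∘ ιW) y = 0 :=
      htnear.mono fun y hy ↦ (hFH (ι y) hy).1 (hιH ⟨y, rfl⟩)
    have hKnormal : ∀ᶠ y in 𝓝 t, ∀ w : TangentSpace (𝓡 2) y,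
        gW.val (ιW y) (KW (ιW y)) (mfderiv (𝓡 2) (𝓡 4) ιW y w) = 0 := by
      filter_upwards [hzero.eventually_nhds, htnear] with y hy hyW w
      -- `d(FW ∘ ιW)_y = 0`
      have hιWd : MDifferentiableAt (𝓡 2) (𝓡 4) ιW y := hιWsmooth.mdifferentiableAt (by simp)
      have hFWd : MDifferentiableAt (𝓡 4) 𝓘(ℝ, ℝ) FW (ιW y) :=
        (hFWat (ιW y) hyW).mdifferentiableAt (by simp)
      have hcomp : mfderiv (𝓡 2) 𝓘(ℝ, ℝ) (FW ∘ ιW) y =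
          (mfderiv (𝓡 4) 𝓘(ℝ, ℝ) FW (ιW y)).comp (mfderiv (𝓡 2) (𝓡 4) ιW y) :=
        mfderiv_comp y hFWd hιWd
      have hz : mfderiv (𝓡 2) 𝓘(ℝ, ℝ) (FW ∘ ιW) y = 0 := by
        have h0 : (FW ∘ ιW) =ᶠ[𝓝 y] (fun _ ↦ (0 : ℝ)) := hy
        rw [h0.mfderiv_eq]
        exact mfderiv_const
      have happ := congrArg (fun L ↦ L w) (hcomp.symm.trans hz)
      have h1 : mvfderiv (𝓡 4) FW (ιW y) (mfderiv (𝓡 2) (𝓡 4) ιW y w) = 0 := happ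
      -- `dFW_{ιW y} = c_y g(K, ·)` with `c_y ≠ 0`
      obtain ⟨cy, hcy, hdFy⟩ := hFc (ι y) ⟨hyW, hιH ⟨y, rfl⟩⟩
      rw [hdFW (ιW y) hyW, hdFy] at h1
      exact (mul_eq_zero.1 h1).resolve_left hcy
    have hKA : ∀ w : EuclideanSpace ℝ (Fin 2), gW.val pW (KW pW) (A w) = 0 := hKnormal.self_of_nhds
    have hdFA : ∀ w : EuclideanSpace ℝ (Fin 2), mvfderiv (𝓡 4) FW pW (A w) = 0 := fun w ↦ by
      rw [hdFWp, hKA, mul_zero]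
    -- ### NH-F: the null frame at `p`
    obtain ⟨e₁, e₂, N, h₁₁, h₂₂, h₁₂, hNN, hKN, hNA, hsq⟩ := hF W' gW pW A (KW pW) hApos hKp0 hKnull hKA
    -- ### NH-G: the null Gauss equation at `t`
    have hBzero : ∀ v w : TangentSpace (𝓡 2) t,
        gW.val (ιW t) (gW.leviCivita KW (ιW t) (mfderiv (𝓡 2) (𝓡 4) ιW t v))
          (mfderiv (𝓡 2) (𝓡 4) ιW t w) = 0 := fun v w ↦ hBW (A v) (A w) (hdFA v) (hdFA w)
    have hGauss := hG W' gW T ιW hιWsp KW Set.univ t N isOpen_univ (mem_univ _)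
      hKW.contMDiff.contMDiffOn hKnormal hKnull hNN hKN hNA hBzero
    -- ### NH3 (vacuum) and NH6 (`S = 2K`)
    have hricci : gW.ricci pW = 0 := hvacW pW
    have hC1 := hC.1 W' gW pW (KW pW) N (A e₁) (A e₂) hricci hKnull hNN hKN h₁₁ h₂₂ h₁₂
      (hKA e₁) (hKA e₂) (hNA e₁) (hNA e₂)
    have hC2 := hC.2 T γT t e₁ e₂ (by rw [hγval]; exact h₁₁) (by rw [hγval]; exact h₂₂)
      (by rw [hγval]; exact h₁₂)
    -- ### `Q(N) ≤ 0` along an integral curve of an extension `Y` of `N` (NH1 + NH2)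
    set Y : Π y : W', TangentSpace (𝓡 4) y := FiberBundle.extend E4 N with hYdef
    have hYp : Y pW = N := FiberBundle.extend_apply_self E4 N
    have hYsmooth : ∀ᶠ y in 𝓝 pW, ContMDiffAt (𝓡 4) ((𝓡 4).prod 𝓘(ℝ, E4)) ∞
        (fun x ↦ (TotalSpace.mk' E4 x (Y x) : TangentBundle (𝓡 4) W')) y := by
      obtain ⟨s, hs, hsm⟩ := FiberBundle.exists_contMDiffOn_extend (𝓡 4) E4 (k := ∞)
        (V := (TangentSpace (𝓡 4) : W' → Type _)) N
      filter_upwards [interior_mem_nhds.2 hs] with y hy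
      exact hsm.contMDiffAt (mem_interior_iff_mem_nhds.1 hy)
    have hY1 : ContMDiffAt (𝓡 4) (𝓡 4).tangent 1
        (fun x ↦ (TotalSpace.mk' E4 x (Y x) : TangentBundle (𝓡 4) W')) pW :=
      hYsmooth.self_of_nhds.of_le (by norm_num)
    obtain ⟨γc, hγ0, hγint⟩ :=
      exists_isMIntegralCurveAt_of_contMDiffAt_boundaryless (t₀ := (0 : ℝ)) hY1
    obtain ⟨hYf0, hder1, hder2⟩ := hD W' gW KW Y γc pW hKW hYsmooth hγ0 hγint hdegW
    -- the curve stays near `pW`: in `Wd` (read through `val`)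
    have hγd0 : HasMFDerivAt 𝓘(ℝ, ℝ) (𝓡 4) γc 0 ((1 : ℝ →L[ℝ] ℝ).smulRight (Y (γc 0))) :=
      hγint.self_of_nhds
    have hγcont : ContinuousAt γc 0 := hγd0.continuousAt
    have hγnear : ∀ᶠ s in 𝓝 (0 : ℝ), (γc s).1 ∈ Wd := by
      have h : ∀ᶠ y in 𝓝 (γc 0), y.1 ∈ Wd := by rw [hγ0]; exact hnear
      exact hγcont.eventually h
    -- `ψ = FW ∘ γc` is differentiable at `0` with `ψ'(0) = c g(K, N) ≠ 0`
    have hψ : HasDerivAt (fun s ↦ FW (γc s)) (mvfderiv (𝓡 4) FW (γc 0) (Y (γc 0))) 0 :=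
      nh_hasDerivAt_comp_of_hasMFDerivAt
        ((hFWat (γc 0) (by rw [hγ0]; exact hpWd)).mdifferentiableAt (by simp)) hγd0
    have hψ' : deriv (fun s ↦ FW (γc s)) 0 ≠ 0 := by
      rw [hψ.deriv, hγ0, hYp, hdFWp N]
      exact mul_ne_zero hc hKN
    -- the collar, read along the curve
    have hcollar : ∀ᶠ s in 𝓝 (0 : ℝ), FW (γc s) < 0 →
        gW.val (γc s) (KW (γc s)) (KW (γc s)) ≤ 0 := by
      filter_upwards [hγnear] with s hs hFs0
      have hdoc : (γc s).1 ∈ 𝓑.doc := (hFdoc _ hs).2 hFs0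
      exact hno (γc s).1 ⟨(γc s).2.2, hdoc⟩
    have hQ : 2 * (gW.val pW (gW.riemann pW (Y pW) (KW pW) (Y pW)) (KW pW) +
        gW.val pW (gW.leviCivita KW pW (Y pW)) (gW.leviCivita KW pW (Y pW))) ≤ 0 := by
      refine hT (fun s ↦ gW.val (γc s) (KW (γc s)) (KW (γc s)))
        (fun s ↦ mvfderiv (𝓡 4) (fun y ↦ gW.val y (KW y) (KW y)) (γc s) (Y (γc s)))
        (fun s ↦ FW (γc s)) _ hder1 hder2 hψ.differentiableAt hcollar ?_ ?_ hψ' ?_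
      · show FW (γc 0) = 0
        rw [hγ0]; exact hFWp
      · show gW.val (γc 0) (KW (γc 0)) (KW (γc 0)) = 0
        rw [hγ0]; exact hKnull
      · show mvfderiv (𝓡 4) (fun y ↦ gW.val y (KW y) (KW y)) (γc 0) (Y (γc 0)) = 0
        rw [hγ0]; exact hYf0
    rw [hYp] at hQ
    -- ### `∇_N K ⊥ K, N`, hence spacelike
    have hXK : gW.val pW (gW.leviCivita KW pW N) (KW pW) = 0 := by
      have h := hKW.val_leviCivita_add pW N (KW pW)
      rw [hdegW, map_zero, add_zero] at h
      exact h
    have hXN : gW.val pW (gW.leviCivita KW pW N) N = 0 := by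
      have h := hKW.val_leviCivita_add pW N N
      rw [gW.symm pW N (gW.leviCivita KW pW N)] at h
      linarith
    have hsq' : 0 ≤ gW.val pW (gW.leviCivita KW pW N) (gW.leviCivita KW pW N) := by
      rw [hsq _ hXK hXN]; positivity
    -- ### conclusion at `t`
    have hKN2 : 0 < (gW.val pW (KW pW) N) ^ 2 := by positivity
    have hsec : gW.val pW (gW.riemann pW (A e₂) (A e₁) (A e₁)) (A e₂) ≤ 0 := by
      by_contra hpos
      push Not at hpos
      have : 0 < (gW.val pW (KW pW) N) ^ 2 * gW.val pW (gW.riemann pW (A e₂) (A e₁) (A e₁)) (A e₂) :=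
        mul_pos hKN2 hpos
      linarith
    have hG21 := hGauss e₂ e₁
    have hsec' : gW.val (ιW t) (gW.riemann (ιW t) (mfderiv (𝓡 2) (𝓡 4) ιW t e₂)
        (mfderiv (𝓡 2) (𝓡 4) ιW t e₁) (mfderiv (𝓡 2) (𝓡 4) ιW t e₁)) (mfderiv (𝓡 2) (𝓡 4) ιW t e₂) ≤ 0 :=
      hsec
    rw [hC2, hG21]
    linarith
  -- ## Gauss–Bonnet
  letI : MeasurableSpace T := borel T
  haveI : BorelSpace T := ⟨rfl⟩
  have hGB := Literature.Geometry.Riemannian.gaussBonnet γT hγR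
  have hχ : relEuler ℤ ℤ T ∅ = 2 := by
    rw [relEuler_eq_of_homeomorph (R := ℤ) (M := ℤ) (A := (∅ : Set T))
      (B := (∅ : Set (Metric.sphere (0 : E3) 1))) eT (mapsTo_empty _ _) (mapsTo_empty _ _)]
    exact Literature.Topology.Euclidean.finRelHomology_sphere_two.2
  have hint : ∫ t, γT.scalarCurvature t ∂(riemannianVolume (γT.toContMDiffRiemannianMetric hγR) 2) ≤ 0 :=
    integral_nonpos fun t ↦ hSle t
  rw [hGB, hχ] at hint
  have hπ := Real.pi_pos
  push_cast at hint
  linarith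

end Assembly


/-- **Registered sub-goal form of the NH assembly** (closed statement, crux
stmt-FinalStateConjecture-17840): the no-collar statement given the defining functions, from the
null Gauss equation (the lead's remaining stub) and the spherical-section fact, the other NH bricks
being the LANDED theorems `stub_nh_oneSidedTaylor` (p155467), `stub_nh_secondDerivative` (p155709),
`stub_nh_curvatureAlgebra` (p155941), `stub_nh_secondFF` (p155792), `stub_nh_nullFrame` (p155977). -/
theorem stub_nh_assembly : (∀ (M : Type) [TopologicalSpace M] [ChartedSpace E4 M] [IsManifold (𝓡 4) ∞ M] (g : PseudoRiemannianMetric (𝓡 4) ∞ E4 (TangentSpace (𝓡 4) : M → Type _)) [g.HasLeviCivita] (S : Type) [TopologicalSpace S] [ChartedSpace (EuclideanSpace ℝ (Fin 2)) S] [IsManifold (𝓡 2) ∞ S] (ι : S → M) (hι : g.IsSpacelikeImmersion (𝓡 2) ι) (K : Π x : M, TangentSpace (𝓡 4) x) (U : Set M) (s : S) (N : TangentSpace (𝓡 4) (ι s)), IsOpen U → ι s ∈ U → ContMDiffOn (𝓡 4) ((𝓡 4).prod 𝓘(ℝ, E4)) ∞ (fun x ↦ (Bundle.TotalSpace.mk'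 E4 x (K x) : TangentBundle (𝓡 4) M)) U → (∀ᶠ y in 𝓝 s, ∀ w : TangentSpace (𝓡 2) y, g.val (ι y) (K (ι y)) (mfderiv (𝓡 2) (𝓡 4) ι y w) = 0) → g.val (ι s) (K (ι s)) (K (ι s)) = 0 → g.val (ι s) N N = 0 → g.val (ι s) (K (ι s)) N ≠ 0 → (∀ w : TangentSpace (𝓡 2) s, g.val (ι s) N (mfderiv (𝓡 2) (𝓡 4) ι s w) = 0) → (∀ v w : TangentSpace (𝓡 2) s, g.val (ι s) (g.leviCivita K (ι s) (mfderiv (𝓡 2) (𝓡 4) ι s v)) (mfderiv (𝓡 2) (𝓡 4) ι s w) = 0) → ∀ [(g.inducedMetric ι PseudoRiemannianMetric.contMDiff_pullbackBilin_holds hι).HasLeviCivita], ∀ v w : TangentSpace (𝓡 2) s, (g.inducedMetric ι PseudoRiemannianMetric.contMDiff_pullbackBilin_holds hι).val s ((g.inducedMetric ι PseudoRiemannianMetric.contMDiff_pullbackBilin_holds hι).riemann s v w w) v = g.val (ι s) (g.riemann (ι s) (mfderiv (𝓡 2) (𝓡 4) ι s v) (mfderiv (𝓡 2) (𝓡 4)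 ι s w) (mfderiv (𝓡 2) (𝓡 4) ι s w)) (mfderiv (𝓡 2) (𝓡 4) ι s v)) → chruscielCosta2008_horizonSphericalSection → ∀ (𝓑 : StationaryAFBlackHole.{0}) [𝓑.metric.HasLeviCivita], 𝓑.metric.toPseudoRiemannianMetric.IsRicciFlat → 𝓑.IsIPlusRegular → IsConnected 𝓑.horizon → SimplyConnectedSpace 𝓑.doc → ∀ (U : Set 𝓑.carrier) (K : Π x : 𝓑.carrier, TangentSpace (𝓡 4) x), IsOpen U → 𝓑.horizon ⊆ U → 𝓑.metric.toPseudoRiemannianMetric.IsKillingFieldOn K U → (∀ x ∈ U, VectorField.mlieBracket (𝓡 4) 𝓑.killing K x = 0) → (∀ p ∈ 𝓑.horizon, K p ≠ 0) → (∀ p ∈ 𝓑.horizon, 𝓑.metric.val p (K p) (K p) = 0) → (∀ p ∈ 𝓑.horizon, ∃ ε > (0 : ℝ), ∃ γ : ℝ → 𝓑.carrier, γ 0 = p ∧ IsMIntegralCurveOn γ K (Set.Ioo (-ε) ε) ∧ ∀ t ∈ Set.Ioo (-ε) ε, γ t ∈ 𝓑.horizon) → (∀ p ∈ 𝓑.horizon,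 𝓑.metric.leviCivita K p (K p) = 0) → (∀ p ∈ 𝓑.horizon, ∃ W : Set 𝓑.carrier, IsOpen W ∧ p ∈ W ∧ W ⊆ U ∧ ∃ F : 𝓑.carrier → ℝ, ContMDiffOn (𝓡 4) 𝓘(ℝ, ℝ) ((⊤ : ℕ∞) : WithTop ℕ∞) F W ∧ (∀ x ∈ W, x ∈ 𝓑.horizon ↔ F x = 0) ∧ (∀ x ∈ W, x ∈ 𝓑.doc ↔ F x < 0) ∧ ∀ x ∈ W ∩ 𝓑.horizon, ∃ c : ℝ, c ≠ 0 ∧ ∀ w : TangentSpace (𝓡 4) x, mfderiv (𝓡 4) 𝓘(ℝ, ℝ) F x w = c * 𝓑.metric.val x (K x) w) → ∀ V : Set 𝓑.carrier, IsOpen V → 𝓑.horizon ⊆ V → ∃ x ∈ V ∩ 𝓑.doc, 0 < 𝓑.metric.val x (K x) (K x) :=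
  fun hG hS ↦ noCollar_of_bricks stub_nh_oneSidedTaylor stub_nh_secondDerivative stub_nh_curvatureAlgebra
    stub_nh_secondFF hG stub_nh_nullFrame hS

end Summit.FinalStateConjecture.FinalStateConjecture.Theorems.HawkingExtensionIsKerr.SketchIdeator2

end
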